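import Mathlib
import Summits.ResolutionOfSingularities.ResolutionOfSingularities.Theorems.WeightedInvariantLocalWeightedDropTOT2E1Presentation
import Summits.ResolutionOfSingularities.ResolutionOfSingularities.Theorems.WeightedInvariantLocalWeightedDropRestrictedChartTransport
import Summits.ResolutionOfSingularities.ResolutionOfSingularities.Theorems.WeightedInvariantLocalWeightedDropAxisNearDescentStep
import Summits.ResolutionOfSingularities.ResolutionOfSingularities.Theorems.WeightedInvariantLocalWeightedDropTOT2Near

/-!
# `LocalWeightedDrop`, TOT2-LINE piece S-E1 (decorated half): THE AXIS STEP THEOREM — one identity point blow-up from a germ with a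
# prepared axis presentation, read at EVERY answer of the count game

Route `ResolutionOfSingularities/WeightedInvariant`, engine crux `LocalWeightedDrop` (stmt-ResolutionOfSingularities-8899), chain w43
[OURS · L1 W4.3 · TOT2-LINE v1.1 §(E) S-E1; decorated half = res-type-056, core = res-L1-w43-stub-4 (`…AxisNearDescent*`), near points =
res-L1-w43-stub-3 (`…TOT2Near`), transport = (T1) `…RestrictedChartTransport`].  Nothing here is a statement of any manuscript.  No definitions.

SETTING.  `g ∈ k⟦x₀, …, xₙ⟧` of order `d` with a PREPARED AXIS PRESENTATION: a formal coordinate change `θ` and a unit `u` with `θ^* g = u · P`,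
`P` an axis germ (`AxisCone d`, `TrivialApexX d`) that is Hironaka-prepared (`PreparedAxis d`) with a failing integer level `r`
(`¬ AboveLevel d r 1 P`, i.e. `δ(P; x'; z) < r`; the core's integer measure).  The count game plays the IDENTITY POINT BLOW-UP from `g` (in
`g`'s own letters); an answer is an exceptional point `c` with a live slot `i` (`c_i ≠ 0`) and `g(s(c + y)) = s^d · G`; the new germ is the
slice `G|_{y_i = 0}`.
* `initEval_subst_legal`, `apexTrivial_unit_mul_subst` — the degree-`d` form under a formal coordinate change is the form composed with the
  LINEAR PART; «no invariance vector» is transported through units and formal coordinate changes;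
* `order_slice_lt_of_offAxis` — B3's off-axis half in slice form: at an exceptional point of an axis germ OFF the axis the sliced strict transform
  has order `< d` (near ⇒ invariance vector (`TOT2Near.initEval_add_smul_eq_of_near`) ⇒ inside `z = 0` by `AxisCone`, against `TrivialApexX`);
* `subst_chi_rename_rot` — reading the rotated near successor of the core files through a formal coordinate change.
* **`axisStep`** — THE AXIS STEP THEOREM: at every answer, the order drops, or the new germ has a prepared axis presentation whose failing
  integer level is one less, or (the `δ = 2` boundary) its degree-`d` form has no non-zero invariance vector.
-/

set_option linter.dupNamespace false -- mandated namespace of this single-conjunct summit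

namespace Summit.ResolutionOfSingularities.ResolutionOfSingularities.Theorems

open Literature.AlgebraicGeometry.Resolution

namespace TOT2E1

open MvPowerSeries AxisPolyhedron

variable {k : Type} [Field k] {n : ℕ}

/-! ### The degree-`d` form under formal coordinate changes -/

/-- **THE DEGREE-`d` FORM OF `θ^* f` IS `in_d f ∘ L`**, `L` the linear part of the formal coordinate change `θ`, `d = ord f`
(factor `θ` as linear ∘ tangent-to-identity; the latter does not touch the coefficients of degree `≤ ord`). -/
theorem initEval_subst_legal (θ : Fin (n + 1) → MvPowerSeries (Fin (n + 1)) k) (hθ0 : ∀ i, constantCoeff (θ i) = 0)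
    (hθdet : IsUnit (Matrix.det (Matrix.of fun i j : Fin (n + 1) => coeff (Finsupp.single j 1) (θ i))))
    (f : MvPowerSeries (Fin (n + 1)) k) {d : ℕ} (hfd : f.order = d) (v : Fin (n + 1) → k) :
    CobordantChart.initEval (fun _ : Fin (n + 1) => 1) v d (subst θ f) =
      CobordantChart.initEval (fun _ : Fin (n + 1) => 1)
        ((Matrix.of fun i j : Fin (n + 1) => coeff (Finsupp.single j 1) (θ i)).mulVec v) d f := by
  have hdet : IsUnit (FormalCoordChange.linMat θ).det := hθdet
  set h : MvPowerSeries (Fin (n + 1)) k := subst (FormalCoordChange.linSubst (FormalCoordChange.linMat θ)) f with hh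
  have hhd : h.order = d := by
    rw [hh, order_subst_eq_of_legal _ (ConeDichotomy.constantCoeff_linSubst _) ?_ f, hfd]
    rw [ConeDichotomy.linMat_linSubst]
    exact hdet
  rw [FormalCoordChange.subst_eq_subst_normalize hθ0 hdet f, ← hh]
  rw [AxisPreparation.initEval_congr (g := h) (fun E hE =>
    (FormalCoordChange.tangentId_normalize hθ0 hdet).coeff_subst_of_degree_le h E (by rw [hhd]; exact_mod_cast hE.le))]
  rw [hh, AxisNormalize.initEval_subst_linSubst 0]
  rfl

/-- **«NO INVARIANCE VECTOR» IS TRANSPORTED** through a unit factor and a formal coordinate change: if the degree-`d` form of `Q` (`ord Q = d`)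
has no non-zero translation-invariance vector, neither has that of `U · χ^* Q`. -/
theorem apexTrivial_unit_mul_subst (χ : Fin (n + 1) → MvPowerSeries (Fin (n + 1)) k) (hχ0 : ∀ i, constantCoeff (χ i) = 0)
    (hχdet : IsUnit (Matrix.det (Matrix.of fun i j : Fin (n + 1) => coeff (Finsupp.single j 1) (χ i))))
    (U : MvPowerSeries (Fin (n + 1)) k) (hU : constantCoeff U ≠ 0) (Q : MvPowerSeries (Fin (n + 1)) k) {d : ℕ} (hQd : Q.order = d)
    (hapex : ∀ u : Fin (n + 1) → k,
      (∀ v, CobordantChart.initEval (fun _ : Fin (n + 1) => 1) (v + u) d Q = CobordantChart.initEval (fun _ : Fin (n + 1) => 1) v d Q) →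
      u = 0)
    (u : Fin (n + 1) → k)
    (hu : ∀ v, CobordantChart.initEval (fun _ : Fin (n + 1) => 1) (v + u) d (U * subst χ Q) =
      CobordantChart.initEval (fun _ : Fin (n + 1) => 1) v d (U * subst χ Q)) : u = 0 := by
  set L : Matrix (Fin (n + 1)) (Fin (n + 1)) k := Matrix.of fun i j : Fin (n + 1) => coeff (Finsupp.single j 1) (χ i) with hL
  have hdet : IsUnit L.det := hχdet
  have hQ' : (subst χ Q).order = d := by rw [order_subst_eq_of_legal χ hχ0 hχdet Q, hQd]
  have hread : ∀ v, CobordantChart.initEval (fun _ : Fin (n + 1) => 1) v d (U * subst χ Q) =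
      constantCoeff U * CobordantChart.initEval (fun _ : Fin (n + 1) => 1) (L.mulVec v) d Q := by
    intro v
    rw [initEval_unit_mul U (subst χ Q) hQ'.symm.le, initEval_subst_legal χ hχ0 hχdet Q hQd]
  have hLu : L.mulVec u = 0 := by
    refine hapex (L.mulVec u) fun y => ?_
    have h := hu (L⁻¹.mulVec y)
    rw [hread, hread, Matrix.mulVec_add, AxisNormalize.mulVec_nonsing_inv_mulVec hdet] at h
    exact mul_left_cancel₀ hU h
  exact AxisNormalize.eq_zero_of_mulVec_eq_zero hdet hLu

/-! ### B3, off-axis half, slice form -/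

/-- **OFF THE AXIS THE ORDER DROPS.**  For an axis germ `P` of order `d` (`AxisCone`, `TrivialApexX`), at an exceptional point `c̃` of the point
blow-up with some `x'`-coordinate non-zero and a live slot `ĩ`, the sliced strict transform has order `< d`: a near point would make `c̃` a
translation-invariance vector of the form (`TOT2Near.initEval_add_smul_eq_of_near`), which by `AxisCone` only sees the `x'`-part, against the
trivial apex inside `z = 0`. -/
theorem order_slice_lt_of_offAxis {P : MvPowerSeries (Fin (n + 1)) k} {d : ℕ} (hcone : AxisCone d P) (hapex : TrivialApexX d P)
    {ct : Fin (n + 1) → k} (hoff : ∃ j : Fin n, ct (Fin.castSucc j) ≠ 0) {ĩ : Fin (n + 1)} (hĩ : ct ĩ ≠ 0)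
    {GP : MvPowerSeries (Fin (n + 1 + 1)) k}
    (hfacP : subst (CobordantChart.chart (fun _ : Fin (n + 1) => 1) ct) P = X 0 ^ d * GP) :
    (TupleGame.slice ĩ GP).order < d := by
  by_contra hge
  push Not at hge
  have hinv := TOT2Near.initEval_add_smul_eq_of_near P ct ĩ hĩ hfacP hge 1
  obtain ⟨v, hv⟩ := hapex (fun j => ct (Fin.castSucc j)) (fun h0 => by
    obtain ⟨j, hj⟩ := hoff
    exact hj (congrFun h0 j))
  apply hv
  have h1 : CobordantChart.initEval (fun _ : Fin (n + 1) => 1)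
      ((Fin.snoc v 0 : Fin (n + 1) → k) + Fin.snoc (fun j => ct (Fin.castSucc j)) 0) d P =
      CobordantChart.initEval (fun _ : Fin (n + 1) => 1) ((Fin.snoc v 0 : Fin (n + 1) → k) + (1 : k) • ct) d P :=
    AxisPointMove.initEval_eq_of_axisCone hcone fun j => by simp
  rw [h1, hinv]

/-! ### Reading the rotated near successor through a coordinate change -/

/-- The index permutation of a substitution family by an equivalence keeps zero constant terms. -/
theorem constantCoeff_comp_equiv {χ : Fin (n + 1) → MvPowerSeries (Fin (n + 1)) k} (hχ0 : ∀ i, constantCoeff (χ i) = 0)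
    (e : Fin (n + 1) ≃ Fin (n + 1)) (i : Fin (n + 1)) : constantCoeff ((χ ∘ e) i) = 0 := hχ0 (e i)

/-- … and an invertible linear part (the rows are permuted). -/
theorem isUnit_det_comp_equiv {χ : Fin (n + 1) → MvPowerSeries (Fin (n + 1)) k}
    (hχdet : IsUnit (Matrix.det (Matrix.of fun i j : Fin (n + 1) => coeff (Finsupp.single j 1) (χ i))))
    (e : Fin (n + 1) ≃ Fin (n + 1)) :
    IsUnit (Matrix.det (Matrix.of fun i j : Fin (n + 1) => coeff (Finsupp.single j 1) ((χ ∘ e) i))) := by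
  have hsub : (Matrix.of fun i j : Fin (n + 1) => coeff (Finsupp.single j 1) ((χ ∘ e) i)) =
      (Matrix.of fun i j : Fin (n + 1) => coeff (Finsupp.single j 1) (χ i)).submatrix e id := by
    ext i j; rfl
  rw [hsub, Matrix.det_permute]
  exact (Units.isUnit _).map (Int.castRingHom k) |>.mul hχdet

/-- **READING THE ROTATED SUCCESSOR**: with `Nn := rename rot⁻¹ Sl` (`rot = finRotate (n+1)`, the core files' convention),
`χ^* Sl = (χ ∘ rot)^* Nn`. -/
theorem subst_chi_rename_rot {χ : Fin (n + 1) → MvPowerSeries (Fin (n + 1)) k} (hχ0 : ∀ i, constantCoeff (χ i) = 0)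
    (Sl : MvPowerSeries (Fin (n + 1)) k) :
    subst χ Sl = subst (χ ∘ ⇑(finRotate (n + 1))) (rename (⇑(finRotate (n + 1)).symm) Sl) := by
  have hρ0 : ∀ i, constantCoeff ((X ∘ ⇑(finRotate (n + 1)).symm : Fin (n + 1) → MvPowerSeries (Fin (n + 1)) k) i) = 0 :=
    fun i => constantCoeff_X _
  have hσ0 : ∀ i, constantCoeff ((X ∘ ⇑(finRotate (n + 1)) : Fin (n + 1) → MvPowerSeries (Fin (n + 1)) k) i) = 0 :=
    fun i => constantCoeff_X _
  have hback : subst (X ∘ ⇑(finRotate (n + 1))) (rename (⇑(finRotate (n + 1)).symm) Sl) = Sl := by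
    rw [rename_eq_subst]
    refine subst_subst_of_comp_eq_X hρ0 hσ0 (fun s => ?_) Sl
    rw [Function.comp_apply, subst_X (hasSubst_of_constantCoeff_zero hσ0), Function.comp_apply, Equiv.apply_symm_apply]
  conv_lhs => rw [← hback]
  rw [subst_subst_eq_subst_comp hσ0 hχ0]
  congr 1
  funext l
  rw [Function.comp_apply, subst_X (hasSubst_of_constantCoeff_zero hχ0), Function.comp_apply]

/-! ### The axis step theorem -/

/-- **THE AXIS STEP THEOREM** (every dimension; `k` infinite for the `δ = 2` boundary).  Let `g` have order `d ≥ 1` and a PREPARED AXIS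
PRESENTATION `θ^* g = u · P` (`θ` a formal coordinate change, `u(0) ≠ 0`, `P` an axis germ — `AxisCone`, `TrivialApexX` — that is
`PreparedAxis`, with a failing integer level `r`: `¬ AboveLevel d r 1 P`, i.e. `δ(P) < r`).  Play the identity point blow-up from `g` and let
`(c, i)` be any answer with live slot `i` (`c_i ≠ 0`), `g(s(c + y)) = s^d · G`.  Then the new germ `G|_{y_i = 0}`
* has order `< d` (the head drops), OR
* has order `d` and a prepared axis presentation with failing level `r - 1` (and `3 ≤ r`), OR
* has order `d` and a degree-`d` form WITHOUT non-zero translation-invariance vectors (so its own point blow-up has no near answer).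
Proof: transport the answer to the prepared coordinates (`RestrictedChartTransport.exists_transport` on the inverse of `θ`); off the axis the
order drops (`order_slice_lt_of_offAxis`); at the axis point read the core (`AxisNearDescent.nearSucc_step`, `order_nearSucc_lt`,
`not_aboveLevel_nearSucc`, `apexFree_slice_pointMove`) on the rotated slice and carry it back through the transporting coordinate change and
the unit. -/
theorem axisStep [Infinite k] (g : MvPowerSeries (Fin (n + 1)) k) {d : ℕ} (hd : 1 ≤ d) (hgd : g.order = d)
    (θ : Fin (n + 1) → MvPowerSeries (Fin (n + 1)) k) (hθ0 : ∀ l, constantCoeff (θ l) = 0)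
    (hθdet : IsUnit (Matrix.det (Matrix.of fun a j : Fin (n + 1) => coeff (Finsupp.single j 1) (θ a))))
    (u P : MvPowerSeries (Fin (n + 1)) k) (hu : constantCoeff u ≠ 0) (hgP : subst θ g = u * P)
    (hcone : AxisCone d P) (hapex : TrivialApexX d P) (hprep : PreparedAxis d P) {r : ℕ} (hr : ¬ AboveLevel d r 1 P)
    {c : Fin (n + 1) → k} {i : Fin (n + 1)} (hci : c i ≠ 0) {Gg : MvPowerSeries (Fin (n + 1 + 1)) k}
    (hfac : subst (CobordantChart.chart (fun _ : Fin (n + 1) => 1) c) g = X 0 ^ d * Gg) :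
    (TupleGame.slice i Gg).order < (d : ℕ∞) ∨
    ((TupleGame.slice i Gg).order = d ∧
      ∃ (θ' : Fin (n + 1) → MvPowerSeries (Fin (n + 1)) k) (u' P' : MvPowerSeries (Fin (n + 1)) k),
        (∀ l, constantCoeff (θ' l) = 0) ∧
        IsUnit (Matrix.det (Matrix.of fun a j : Fin (n + 1) => coeff (Finsupp.single j 1) (θ' a))) ∧
        constantCoeff u' ≠ 0 ∧ subst θ' (TupleGame.slice i Gg) = u' * P' ∧
        AxisCone d P' ∧ TrivialApexX d P' ∧ PreparedAxis d P' ∧ ¬ AboveLevel d (r - 1) 1 P' ∧ 3 ≤ r) ∨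
    ((TupleGame.slice i Gg).order = d ∧
      ∀ v : Fin (n + 1) → k, (∀ x, CobordantChart.initEval (fun _ : Fin (n + 1) => 1) (x + v) d (TupleGame.slice i Gg) =
        CobordantChart.initEval (fun _ : Fin (n + 1) => 1) x d (TupleGame.slice i Gg)) → v = 0) := by
  classical
  have hconv : ∀ (cc : Fin (n + 1) → k) (l : Fin (n + 1)), (fun _ : Fin (n + 1) => (1 : ℕ)) l = 0 → cc l = 0 :=
    fun cc l hl => absurd hl one_ne_zero
  -- (1) the order of `P`
  have hθsub : HasSubst θ := hasSubst_of_constantCoeff_zero hθ0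
  have hPd : P.order = d := by
    rw [← order_unit_mul u P hu, ← hgP, order_subst_eq_of_legal θ hθ0 hθdet g, hgd]
  have hP0 : P ≠ 0 := by
    intro h; rw [h, order_zero] at hPd; exact ENat.top_ne_coe _ hPd
  -- (2) the inverse `ψ` of `θ`: `g = ψ^* u · ψ^* P`
  obtain ⟨ψ, hψ0, hψθ, -⟩ := FormalCoordChange.exists_comp_inverse hθ0 hθdet
  have hψsub : HasSubst ψ := hasSubst_of_constantCoeff_zero hψ0
  have hψdet : IsUnit (Matrix.det (Matrix.of fun a j : Fin (n + 1) => coeff (Finsupp.single j 1) (ψ a))) :=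
    isUnit_det_linMat_of_comp_eq_X hψ0 hψθ
  have hg : g = subst ψ u * subst ψ P := by
    rw [← subst_mul hψsub, ← hgP, subst_subst_of_comp_eq_X hθ0 hψ0 hψθ g]
  -- (3) transport of the restricted chart at `(c, i)` through `ψ`
  obtain ⟨ĩ, χ, w, hct, hχ0, hχdet, hw0, hχz, htr⟩ := RestrictedChartTransport.exists_transport ψ hψ0 hψdet c i hci
  set ct : Fin (n + 1) → k := fun a => ∑ j, coeff (Finsupp.single j 1) (ψ a) * c j with hctdef
  have hct' : ct ĩ ≠ 0 := hct
  have hχsub : HasSubst χ := hasSubst_of_constantCoeff_zero hχ0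
  -- (4) the chart factorisation of `P` at `c̃`
  obtain ⟨aP, GP, hfacP, hGP⟩ := CobordantVertexChart.exists_eq_X_pow_mul_not_dvd
    (CobordantChart.subst_chart_ne_zero (fun _ : Fin (n + 1) => 1) ct (hconv ct) hP0)
  have haP : aP = d := by
    have h := CobordantChart.eq_weightedOrder_of_factor (fun _ : Fin (n + 1) => 1) ct (hconv ct) hP0 hfacP hGP
    change (aP : ℕ∞) = P.order at h
    rw [hPd] at h
    exact_mod_cast h
  rw [haP] at hfacP
  set SlP : MvPowerSeries (Fin (n + 1)) k := TupleGame.slice ĩ GP with hSlPdef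
  -- (5) the two restricted charts
  have hρg : subst (fun l : Fin (n + 1) => X 0 * (C (c l) +
      if l = i then (0 : MvPowerSeries (Fin (n + 1)) k) else X (Fin.predAbove i l.succ))) g = X 0 ^ d * TupleGame.slice i Gg := by
    have h := SliceChart.subst_restrictedChart (fun _ : Fin (n + 1) => 1) c (hconv c) g d Gg hfac i
    simpa only [pow_one, TupleGame.slice] using h
  have hρP : subst (fun a : Fin (n + 1) => X 0 * (C (ct a) +
      if a = ĩ then (0 : MvPowerSeries (Fin (n + 1)) k) else X (Fin.predAbove ĩ a.succ))) P = X 0 ^ d * SlP := by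
    have h := SliceChart.subst_restrictedChart (fun _ : Fin (n + 1) => 1) ct (hconv ct) P d GP hfacP ĩ
    simpa only [pow_one, hSlPdef, TupleGame.slice] using h
  -- (6) `G|_{y_i = 0} = U · χ^* SlP` with a unit `U`
  have hρsub : HasSubst (fun l : Fin (n + 1) => X 0 * (C (c l) +
      if l = i then (0 : MvPowerSeries (Fin (n + 1)) k) else X (Fin.predAbove i l.succ))) :=
    hasSubst_of_constantCoeff_zero fun l => RestrictedChartTransport.constantCoeff_restrictedChart c i l
  set U : MvPowerSeries (Fin (n + 1)) k := subst (fun l : Fin (n + 1) => X 0 * (C (c l) +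
      if l = i then (0 : MvPowerSeries (Fin (n + 1)) k) else X (Fin.predAbove i l.succ))) (subst ψ u) * w ^ d with hUdef
  have hU0 : constantCoeff U ≠ 0 := by
    rw [hUdef, map_mul, map_pow, hw0, one_pow, mul_one,
      constantCoeff_subst_of_constantCoeff_zero _ (fun l => RestrictedChartTransport.constantCoeff_restrictedChart c i l),
      constantCoeff_subst_of_constantCoeff_zero _ hψ0]
    exact hu
  have hSl : TupleGame.slice i Gg = U * subst χ SlP := by
    have h1 : X 0 ^ d * TupleGame.slice i Gg = X 0 ^ d * (U * subst χ SlP) := by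
      rw [← hρg, hg, subst_mul hρsub, htr P, hρP, subst_mul hχsub, subst_pow hχsub, subst_X hχsub, hχz, hUdef, mul_pow]
      ring
    exact mul_left_cancel₀ (pow_ne_zero d (FormalCoordChange.X_ne_zero' (0 : Fin (n + 1)))) h1
  -- (7) reading through the rotation as well: `χ^* SlP = (χ ∘ rot)^* Nn`
  set Nn : MvPowerSeries (Fin (n + 1)) k := rename (⇑(finRotate (n + 1)).symm) SlP with hNndef
  have hχr0 : ∀ l, constantCoeff ((χ ∘ ⇑(finRotate (n + 1))) l) = 0 := constantCoeff_comp_equiv hχ0 _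
  have hχrdet := isUnit_det_comp_equiv hχdet (finRotate (n + 1))
  have hSlr : TupleGame.slice i Gg = U * subst (χ ∘ ⇑(finRotate (n + 1))) Nn := by
    rw [hSl, hNndef, subst_chi_rename_rot hχ0 SlP]
  have hordSl : (TupleGame.slice i Gg).order = SlP.order := by
    rw [hSl, order_unit_mul _ _ hU0, order_subst_eq_of_legal χ hχ0 hχdet]
  have hordNn : (TupleGame.slice i Gg).order = Nn.order := by
    rw [hSlr, order_unit_mul _ _ hU0, order_subst_eq_of_legal _ hχr0 hχrdet]
  -- (8) OFF THE AXIS: the order drops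
  by_cases hoff : ∃ j : Fin n, ct (Fin.castSucc j) ≠ 0
  · left
    rw [hordSl]
    exact order_slice_lt_of_offAxis hcone hapex hoff hct' hfacP
  -- AT THE AXIS POINT: `ĩ = z` and the core applies to the rotated slice `Nn`
  push Not at hoff
  have hĩ : ĩ = Fin.last n := by
    rcases Fin.eq_castSucc_or_eq_last ĩ with ⟨j, hj⟩ | h
    · exact absurd (hj ▸ hoff j) hct'
    · exact h
  subst hĩ
  have hN : Nn = rename (⇑(finRotate (n + 1)).symm)
      (subst (fun j : Fin (n + 2) => if j = (Fin.last n).succ then (0 : MvPowerSeries (Fin (n + 1)) k)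
        else X (Fin.predAbove (Fin.last n) j)) GP) := rfl
  have hordP : ∀ E : Fin (n + 1) →₀ ℕ, coeff E P ≠ 0 → d ≤ E.degree := AxisNearDescent.le_degree_of_coeff_ne_zero hPd
  by_cases h2 : AboveLevel d 2 1 P
  swap
  · -- `δ(P) < 2`: the successor at the axis point is not near
    left
    rw [hordNn]
    exact AxisNearDescent.order_nearSucc_lt hoff hct' hfacP hN hordP h2
  -- `δ(P) ≥ 2`: the successor is near, of order `d`
  obtain ⟨hNd, hNapex, hNprep, hNlev, -, hNcone⟩ :=
    AxisNearDescent.nearSucc_step hoff hct' hfacP hN hPd hcone hapex hprep h2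
  have hordd : (TupleGame.slice i Gg).order = d := by rw [hordNn, hNd]
  by_cases hline : ∃ E : Fin (n + 1) →₀ ℕ, xDeg E < d ∧ E (Fin.last n) = 2 * (d - xDeg E) ∧ coeff E P ≠ 0
  · -- THE `δ = 2` BOUNDARY: the successor is apex-free
    right; right
    refine ⟨hordd, ?_⟩
    have hfree := AxisNearDescent.apexFree_slice_pointMove hoff hct' hfacP h2 hcone hapex hprep hline
    have hapexSl : ∀ v : Fin (n + 1) → k,
        (∀ x, CobordantChart.initEval (fun _ : Fin (n + 1) => 1) (x + v) d SlP =
          CobordantChart.initEval (fun _ : Fin (n + 1) => 1) x d SlP) → v = 0 := by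
      intro v hv
      by_contra hv0
      obtain ⟨x, hx⟩ := hfree v hv0
      exact hx (hv x)
    have hSlPd : SlP.order = d := by rw [← hordSl, hordd]
    rw [hSl]
    exact apexTrivial_unit_mul_subst χ hχ0 hχdet U hU0 SlP hSlPd hapexSl
  · -- THE LINE IS EMPTY: the successor is again a prepared axis germ, one level lower
    push Not at hline
    have hempty : ∀ E : Fin (n + 1) →₀ ℕ, xDeg E < d → E (Fin.last n) = 2 * (d - xDeg E) → coeff E P = 0 := hline
    right; left
    refine ⟨hordd, ?_⟩
    have h3 : 3 ≤ r := AxisNearDescent.three_le_of_not_aboveLevel hd h2 hempty hr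
    have hr' : ¬ AboveLevel d (r - 1) 1 Nn := by
      refine AxisNearDescent.not_aboveLevel_nearSucc hoff hct' hfacP hN hordP (r := r - 1) ?_
      rw [Nat.sub_add_cancel (by omega)]
      exact hr
    -- the presentation: the inverse of `χ ∘ rot`
    obtain ⟨θ', hθ'0, hθ'χ, -⟩ := FormalCoordChange.exists_comp_inverse hχr0 hχrdet
    have hθ'sub : HasSubst θ' := hasSubst_of_constantCoeff_zero hθ'0
    refine ⟨θ', subst θ' U, Nn, hθ'0, isUnit_det_linMat_of_comp_eq_X hθ'0 hθ'χ, ?_, ?_, hNcone hempty, hNapex, hNprep, hr', h3⟩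
    · rw [constantCoeff_subst_of_constantCoeff_zero _ hθ'0]
      exact hU0
    · rw [hSlr, subst_mul hθ'sub, subst_subst_of_comp_eq_X hχr0 hθ'0 hθ'χ Nn]

end TOT2E1

end Summit.ResolutionOfSingularities.ResolutionOfSingularities.Theorems
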